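import Literature.Computability.AlgebraicComplexity.MW21SingNsingComparisonProofs
import Literature.Computability.AlgebraicComplexity.MW21DeterminantHypersurfaceSymmetriesProofs
import Mathlib.LinearAlgebra.Matrix.Dual
import Mathlib.LinearAlgebra.Dual.Lemmas
import HarnessLib

/-!
# Transpose invariance of the non-commutative rank; `τ ∈ 𝒢_{NSING}` (Makam–Wigderson 2021,
# Thm. 1.14, easy inclusion completed) and the small cases of Thms. 1.13 / 1.14

Sibling proof file of `Literature/Computability/AlgebraicComplexity/MW21SingularTuplesNullCone.lean`
(cell `val-lit`, cross-ladder typing row X3-MW21). That file proves `G_{n,m} ≤ 𝒢_{NSING_{n,m}}` and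
records: "for `τ` one needs the transpose invariance of the non-commutative rank, not in the tree".
This file supplies it (V. Makam, A. Wigderson, J. reine angew. Math. **780** (2021) =
arXiv:1909.00857, Thm. 1.14 with §1.2: `ncrk` is unchanged under `X ↦ Xᵗ`), completing the easy
inclusion `G_{n,m} ∪ G_{n,m}·τ ⊆ 𝒢_{NSING_{n,m}}` of Thm. 1.14, and draws the small cases of the two
symmetry theorems that the tree's comparisons `SING_{n,m} = NSING_{n,m}` (`n ≤ 2` or `m ≤ 2`,
`MW21SingNsingComparisonProofs`) and Thm. 1.12 (`MW21DeterminantHypersurfaceSymmetriesProofs`) give for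
free. No new definitions, no new named facts; the facts `makamWigderson2021_thm_1_13/_1_14` (the hard
inclusions, §9 of the source) stay open. Honest framing: nothing here bears on VP versus VNP.

## Proof of the transpose invariance (duality of shrunk subspaces / covers)

In the cover form of the tree (`ncRank_le_of_cover`, `exists_cover_eq_ncRank`): if every `B ∈ 𝓑`
maps `W ≤ F^κ` into `U ≤ F^ι`, then every `Bᵀ` maps the dot-product annihilator `U^⊥ ≤ F^ι` into
`W^⊥ ≤ F^κ` (`(Bᵀy)·w = y·(Bw)`), and `codim U^⊥ + dim W^⊥ = dim U + codim W`; so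
`ncrk(𝓑ᵀ) ≤ ncrk(𝓑)`, and equality by symmetry.

## References

* [MakamWigderson2021] V. Makam, A. Wigderson, J. reine angew. Math. 780 (2021) =
  arXiv:1909.00857, §1.2 (non-commutative rank), Thms. 1.12–1.14.
* [FortinReutenauer2004] M. Fortin, C. Reutenauer, Sém. Lothar. Combin. 52 (2004), Thm. 1 (the
  shrunk-subspace / zero-block form of `ncrk`, symmetric under transposition).
-/

noncomputable section

open Matrix Module

namespace Literature.Computability.AlgebraicComplexity

/-! ### Transpose invariance of `ncRank` -/

section NcRankTranspose

variable {F : Type*} [Field F] {ι κ : Type*} [Fintype ι] [Fintype κ] [DecidableEq ι] [DecidableEq κ]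

/-- The dot-product annihilator `U^⊥ = {y | ∀ u ∈ U, y · u = 0}` of a subspace of `F^ι` has
dimension `#ι − dim U`. [folklore] -/
private theorem finrank_dotAnnihilator (U : Submodule F (ι → F)) :
    finrank F (U.dualAnnihilator.comap ((dotProductEquiv F ι : (ι → F) ≃ₗ[F] _) :
        (ι → F) →ₗ[F] Module.Dual F (ι → F))) + finrank F U = Fintype.card ι := by
  rw [Submodule.comap_equiv_eq_map_symm, LinearEquiv.finrank_map_eq, add_comm,
    Subspace.finrank_add_finrank_dualAnnihilator_eq, finrank_fintype_fun_eq_card]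

/-- Membership in the dot-product annihilator. [folklore] -/
private theorem mem_dotAnnihilator (U : Submodule F (ι → F)) (y : ι → F) :
    y ∈ U.dualAnnihilator.comap ((dotProductEquiv F ι : (ι → F) ≃ₗ[F] _) :
        (ι → F) →ₗ[F] Module.Dual F (ι → F)) ↔ ∀ u ∈ U, y ⬝ᵥ u = 0 := by
  rw [Submodule.mem_comap, Submodule.mem_dualAnnihilator]
  rfl

/-- `ncrk(𝓑ᵀ) ≤ ncrk(𝓑)`: a cover `(U, W)` of `𝓑` gives the cover `(W^⊥, U^⊥)` of `𝓑ᵀ` of the same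
cost. [cite: MakamWigderson2021, §1.2 with Thm. 1.14] -/
theorem ncRank_image_transpose_le (𝓑 : Set (Matrix ι κ F)) :
    ncRank ((fun B : Matrix ι κ F => Bᵀ) '' 𝓑) ≤ ncRank 𝓑 := by
  obtain ⟨U, W, hUW, hcost⟩ := exists_cover_eq_ncRank 𝓑
  have hle := ncRank_le_of_cover ((fun B : Matrix ι κ F => Bᵀ) '' 𝓑)
    (W.dualAnnihilator.comap ((dotProductEquiv F κ : (κ → F) ≃ₗ[F] _) :
        (κ → F) →ₗ[F] Module.Dual F (κ → F)))
    (U.dualAnnihilator.comap ((dotProductEquiv F ι : (ι → F) ≃ₗ[F] _) :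
        (ι → F) →ₗ[F] Module.Dual F (ι → F))) (by
      rintro _ ⟨B, hB, rfl⟩
      rintro _ ⟨y, hy, rfl⟩
      have hy' := (mem_dotAnnihilator U y).mp hy
      rw [mem_dotAnnihilator]
      intro w hw
      rw [Matrix.mulVecLin_apply, Matrix.mulVec_transpose, ← Matrix.dotProduct_mulVec]
      exact hy' _ (hUW B hB ⟨w, hw, rfl⟩))
  have hU := finrank_dotAnnihilator U
  have hW := finrank_dotAnnihilator W
  have hqU := Submodule.finrank_quotient_add_finrank
    (U.dualAnnihilator.comap ((dotProductEquiv F ι : (ι → F) ≃ₗ[F] _) :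
        (ι → F) →ₗ[F] Module.Dual F (ι → F)))
  have hqW := Submodule.finrank_quotient_add_finrank W
  rw [finrank_fintype_fun_eq_card] at hqU hqW
  omega

/-- **Transpose invariance of the non-commutative rank**: `ncrk{B₁ᵀ,…} = ncrk{B₁,…}` (the
shrunk-subspace / zero-block form is symmetric under transposition).
[cite: MakamWigderson2021, §1.2 with Thm. 1.14] -/
theorem ncRank_image_transpose (𝓑 : Set (Matrix ι κ F)) :
    ncRank ((fun B : Matrix ι κ F => Bᵀ) '' 𝓑) = ncRank 𝓑 := by
  refine le_antisymm (ncRank_image_transpose_le 𝓑) ?_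
  have h : 𝓑 = (fun B : Matrix κ ι F => Bᵀ) '' ((fun B : Matrix ι κ F => Bᵀ) '' 𝓑) := by
    rw [Set.image_image]
    simp only [transpose_transpose, Set.image_id']
  conv_lhs => rw [h]
  exact ncRank_image_transpose_le _

end NcRankTranspose

namespace MakamWigderson

variable {n m : ℕ}

/-! ### `τ` preserves `NSING`; the easy inclusion of Thm. 1.14 completed -/

/-- `τ` maps `NSING_{n,m}` into itself (`ncrk` is transpose invariant).
[cite: MakamWigderson2021, Thm. 1.14 (easy inclusion)] -/
theorem transposeMap_mem_NSING {X : Tuple n m} (hX : X ∈ NSING n m) :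
    transposeMap n m X ∈ NSING n m := by
  rw [mem_NSING_iff] at hX ⊢
  have h : Set.range (transposeMap n m X) =
      (fun B : Matrix (Fin n) (Fin n) ℂ => Bᵀ) '' Set.range X := by
    rw [← Set.range_comp]
    rfl
  rwa [h, ncRank_image_transpose]

/-- **`τ ∈ 𝒢_{NSING_{n,m}}`** — PROVED. [cite: MakamWigderson2021, Thm. 1.14 (easy inclusion)] -/
theorem tau_mem_symmetryGroup_NSING : tau n m ∈ symmetryGroup (NSING n m) := by
  refine mem_symmetryGroup_of_subgroup_mapsTo (H := Subgroup.zpowers (tau n m)) (fun h hh X hX => ?_)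
    (Subgroup.mem_zpowers _)
  obtain ⟨k, rfl⟩ := Subgroup.mem_zpowers_iff.mp hh
  have hτ2 : tau n m ^ (2 : ℕ) = 1 := Units.ext (transposeMap_mul_self n m)
  have hk : (tau n m) ^ k = 1 ∨ (tau n m) ^ k = tau n m := by
    rcases Int.even_or_odd k with ⟨j, rfl⟩ | ⟨j, rfl⟩
    · left
      rw [← two_mul, _root_.zpow_mul, show (tau n m) ^ (2 : ℤ) = 1 from by rw [zpow_ofNat, hτ2],
        _root_.one_zpow]
    · right
      rw [_root_.zpow_add, _root_.zpow_mul, show (tau n m) ^ (2 : ℤ) = 1 from by rw [zpow_ofNat, hτ2],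
        _root_.one_zpow, one_mul, zpow_one]
  rcases hk with hk | hk <;> rw [hk]
  · exact hX
  · exact transposeMap_mem_NSING hX

/-- **The inclusion `G_{n,m} ∪ G_{n,m}·τ ⊆ 𝒢_{NSING_{n,m}}` of Thm. 1.14**, PROVED (the reverse
inclusion is the content of the paper, §9). [cite: MakamWigderson2021, Thm. 1.14 (easy inclusion)] -/
theorem mem_symmetryGroup_NSING_of_mem_G_or {g : LinearMap.GeneralLinearGroup ℂ (Tuple n m)}
    (hg : g ∈ G n m ∨ g * tau n m ∈ G n m) : g ∈ symmetryGroup (NSING n m) := by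
  rcases hg with hg | hg
  · exact G_le_symmetryGroup_NSING hg
  · have h1 : g = (g * tau n m) * tau n m := by
      rw [mul_assoc, show tau n m * tau n m = 1 from Units.ext (transposeMap_mul_self n m), mul_one]
    rw [h1]
    exact (symmetryGroup (NSING n m)).mul_mem (G_le_symmetryGroup_NSING hg)
      tau_mem_symmetryGroup_NSING

/-! ### Small cases of Thms. 1.13 / 1.14 -/

/-- For `n ≤ 2` or `m ≤ 2` the two symmetry groups coincide (`SING_{n,m} = NSING_{n,m}` there), so
Thms. 1.13 and 1.14 say the same thing in these cases. [cite: MakamWigderson2021, Thms. 1.13–1.14 with §10] -/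
theorem symmetryGroup_NSING_eq_of_le_two (h : n ≤ 2 ∨ m ≤ 2) :
    symmetryGroup (NSING n m) = symmetryGroup (SING n m) := by
  rw [← SING_eq_NSING_of_le_two h]

/-- **Thm. 1.13 at `m = 1`** (= Thm. 1.12, Frobenius), PROVED: `𝒢_{SING_{n,1}} = G_{n,1} ∪ G_{n,1}·τ`.
[cite: MakamWigderson2021, Thm. 1.13 (case m = 1) = Thm. 1.12] -/
theorem thm_1_13_of_m_eq_one (hn : 1 ≤ n) (g : LinearMap.GeneralLinearGroup ℂ (Tuple n 1)) :
    g ∈ symmetryGroup (SING n 1) ↔ g ∈ G n 1 ∨ g * tau n 1 ∈ G n 1 :=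
  makamWigderson2021_thm_1_12_holds n hn g

/-- **Thm. 1.14 at `m = 1`**, PROVED: `𝒢_{NSING_{n,1}} = G_{n,1} ∪ G_{n,1}·τ`
(`NSING_{n,1} = SING_{n,1}` and Thm. 1.12). [cite: MakamWigderson2021, Thm. 1.14 (case m = 1)] -/
theorem thm_1_14_of_m_eq_one (hn : 1 ≤ n) (g : LinearMap.GeneralLinearGroup ℂ (Tuple n 1)) :
    g ∈ symmetryGroup (NSING n 1) ↔ g ∈ G n 1 ∨ g * tau n 1 ∈ G n 1 := by
  rw [symmetryGroup_NSING_eq_of_le_two (Or.inr (by norm_num))]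
  exact makamWigderson2021_thm_1_12_holds n hn g

end MakamWigderson

namespace MakamWigderson

variable {n m : ℕ}

/-! ### Thms. 1.13 / 1.14 at `n = 1`: `SING_{1,m} = {0}` and `G_{1,m} = GL(Mat_1^m)` -/

/-- `∑ᵢ δ_{ip} Zᵢ = Z_p` for tuples. [folklore] -/
private theorem sum_single_smul'' (Z : Tuple n m) (p : Fin m) :
    ∑ i, (Pi.single p (1 : ℂ) : Fin m → ℂ) i • Z i = Z p := by
  rw [Finset.sum_eq_single p]
  · rw [Pi.single_eq_same, one_smul]
  · intro i _ hip
    rw [Pi.single_eq_of_ne hip, zero_smul]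
  · intro h
    exact absurd (Finset.mem_univ p) h

/-- `SING_{1,m} = {0}`: a tuple of `1 × 1` matrices all of whose linear combinations are singular
vanishes. [cite: MakamWigderson2021, §1.2 (p0005:L7)] -/
theorem SING_one_eq (m : ℕ) : SING 1 m = {0} := by
  ext X
  rw [mem_SING_iff_forall_det_eq_zero, Set.mem_singleton_iff]
  constructor
  · intro h
    funext i
    ext a b
    have h1 := h (Pi.single i 1)
    rw [sum_single_smul'', Matrix.det_fin_one] at h1
    have ha : a = 0 := Fin.fin_one_eq_zero a
    have hb : b = 0 := Fin.fin_one_eq_zero b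
    subst ha hb
    exact h1
  · rintro rfl c
    simp

/-- The matrix of a linear map of `Mat_1^m ≅ ℂ^m`. [cite: MakamWigderson2021, §1.3 (p0006:L18)] -/
private theorem apply_eq_tripleAct_one (g : Tuple 1 m →ₗ[ℂ] Tuple 1 m) (X : Tuple 1 m) :
    g X = tripleAct (fun i j => g (Pi.single j 1) i 0 0) 1 1 X := by
  have hX : X = ∑ j, X j 0 0 • (Pi.single j (1 : Matrix (Fin 1) (Fin 1) ℂ) : Tuple 1 m) := by
    funext i
    ext a b
    have ha : a = 0 := Fin.fin_one_eq_zero a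
    have hb : b = 0 := Fin.fin_one_eq_zero b
    subst ha hb
    rw [Finset.sum_apply, Matrix.sum_apply, Finset.sum_eq_single i]
    · simp
    · intro j _ hji
      rw [Pi.smul_apply, Pi.single_eq_of_ne (Ne.symm hji), smul_zero, Matrix.zero_apply]
    · intro h
      exact absurd (Finset.mem_univ i) h
  funext i
  ext a b
  have ha : a = 0 := Fin.fin_one_eq_zero a
  have hb : b = 0 := Fin.fin_one_eq_zero b
  subst ha hb
  rw [tripleAct_apply]
  conv_lhs => rw [hX]
  simp only [map_sum, map_smul, Finset.sum_apply, Pi.smul_apply, Matrix.sum_apply,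
    Matrix.smul_apply, smul_eq_mul, Fin.sum_univ_one, Matrix.one_apply_eq, mul_one]
  exact Finset.sum_congr rfl fun j _ => mul_comm _ _

/-- `G_{1,m} = GL(Mat_1^m)`: every invertible linear map of `Mat_1^m ≅ ℂ^m` is `X ↦ (∑ⱼ p_{ij}Xⱼ)ᵢ`
with `P ∈ GL_m`. [cite: MakamWigderson2021, §1.3 (p0006:L18)] -/
theorem G_one_eq_top (m : ℕ) : G 1 m = ⊤ := by
  rw [eq_top_iff]
  intro g _
  rw [mem_G_iff]
  set P : Matrix (Fin m) (Fin m) ℂ :=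
    fun i j => (g : Tuple 1 m →ₗ[ℂ] Tuple 1 m) (Pi.single j 1) i 0 0 with hP
  set P' : Matrix (Fin m) (Fin m) ℂ := fun i j =>
    ((g⁻¹ : LinearMap.GeneralLinearGroup ℂ (Tuple 1 m)) : Tuple 1 m →ₗ[ℂ] Tuple 1 m)
      (Pi.single j 1) i 0 0 with hP'
  have hg : ∀ X, (g : Tuple 1 m →ₗ[ℂ] Tuple 1 m) X = tripleAct P 1 1 X :=
    apply_eq_tripleAct_one _
  have hg' : ∀ X, ((g⁻¹ : LinearMap.GeneralLinearGroup ℂ (Tuple 1 m)) :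
      Tuple 1 m →ₗ[ℂ] Tuple 1 m) X = tripleAct P' 1 1 X :=
    apply_eq_tripleAct_one _
  -- `P P' = 1 = P' P` from `g g⁻¹ = 1 = g⁻¹ g`
  have hmul : ∀ (A B : Matrix (Fin m) (Fin m) ℂ),
      (∀ X : Tuple 1 m, tripleAct A 1 1 (tripleAct B 1 1 X) = X) → A * B = 1 := by
    intro A B hAB
    ext i j
    have h := congrFun (hAB (Pi.single j 1)) i
    rw [← Module.End.mul_apply, tripleAct_mul, Matrix.mul_one, tripleAct_apply_eq_sum] at h
    have h' := congrFun (congrFun h 0) 0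
    rw [Matrix.sum_apply, Finset.sum_eq_single j] at h'
    · by_cases hij : i = j
      · subst hij
        simpa using h'
      · simpa [hij, Pi.single_eq_of_ne hij] using h'
    · intro k _ hkj
      rw [Matrix.smul_apply, Matrix.transpose_one, Matrix.mul_one, Matrix.one_mul,
        Pi.single_eq_of_ne hkj, Matrix.zero_apply, smul_zero]
    · intro h
      exact absurd (Finset.mem_univ j) h
  have hPP' : P * P' = 1 := hmul P P' fun X => by
    rw [← hg', ← hg, ← Module.End.mul_apply, ← Units.val_mul, mul_inv_cancel, Units.val_one,
      Module.End.one_apply]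
  have hP'P : P' * P = 1 := hmul P' P fun X => by
    rw [← hg, ← hg', ← Module.End.mul_apply, ← Units.val_mul, inv_mul_cancel, Units.val_one,
      Module.End.one_apply]
  refine ⟨⟨P, P', hPP', hP'P⟩, 1, 1, ?_⟩
  apply LinearMap.ext
  intro X
  rw [hg X]
  simp

/-- **Thm. 1.13 at `n = 1`**, PROVED (both sides hold for every `g`: `SING_{1,m} = {0}` is preserved
by everything and `G_{1,m}` is everything). [cite: MakamWigderson2021, Thm. 1.13 (case n = 1)] -/
theorem thm_1_13_of_n_eq_one (g : LinearMap.GeneralLinearGroup ℂ (Tuple 1 m)) :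
    g ∈ symmetryGroup (SING 1 m) ↔ g ∈ G 1 m ∨ g * tau 1 m ∈ G 1 m := by
  refine ⟨fun _ => Or.inl (by rw [G_one_eq_top]; exact Subgroup.mem_top g), fun _ => ?_⟩
  rw [mem_symmetryGroup_iff, SING_one_eq]
  simp

/-- **Thm. 1.14 at `n = 1`**, PROVED (`NSING_{1,m} = SING_{1,m}`).
[cite: MakamWigderson2021, Thm. 1.14 (case n = 1)] -/
theorem thm_1_14_of_n_eq_one (g : LinearMap.GeneralLinearGroup ℂ (Tuple 1 m)) :
    g ∈ symmetryGroup (NSING 1 m) ↔ g ∈ G 1 m ∨ g * tau 1 m ∈ G 1 m := by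
  rw [symmetryGroup_NSING_eq_of_le_two (Or.inl (by norm_num))]
  exact thm_1_13_of_n_eq_one g

end MakamWigderson

/-! ### Sharpened reductions: Thm. 1.13 alone gives the cores of Thms. 1.9 and 1.8 -/

section Reductions

open MakamWigderson

/-- **`Thm. 1.13 ⇒ Thm. 1.9 (core)`** — the tree's reduction
`makamWigderson2021_thm_1_9_core_of_thm_1_13_of_thm_1_14` with the hypothesis Thm. 1.14 dropped: a
symmetry of `SING` is in `G ∪ G·τ` (Thm. 1.13), hence a symmetry of `NSING` by the easy inclusion of
Thm. 1.14 PROVED above, and coordinate subspaces of `SING` lie in `NSING` (Cor. 10.7, tree).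
[cite: MakamWigderson2021, Thm. 1.9 (proof, §10.2)] -/
theorem makamWigderson2021_thm_1_9_core_of_thm_1_13 (h13 : makamWigderson2021_thm_1_13) :
    makamWigderson2021_thm_1_9_core := by
  intro n m g hg I hI
  rcases Nat.eq_zero_or_pos n with rfl | hn
  · exact absurd hI (not_coordSubspace_subset_SING_zero I)
  rcases Nat.eq_zero_or_pos m with rfl | hm
  · intro Y _
    exact mem_NSING_of_m_eq_zero hn Y
  have hgN : g ∈ symmetryGroup (NSING n m) :=
    mem_symmetryGroup_NSING_of_mem_G_or ((h13 n m hn hm g).mp hg)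
  rw [mem_symmetryGroup_iff] at hgN
  have hIN : coordSubspace I ⊆ NSING n m := (coordSubspace_subset_NSING_iff_subset_SING I).mpr hI
  calc (fun X => (g : Tuple n m →ₗ[ℂ] Tuple n m) X) '' coordSubspace I
      ⊆ (fun X => (g : Tuple n m →ₗ[ℂ] Tuple n m) X) '' NSING n m := Set.image_mono hIN
    _ = NSING n m := hgN

/-- **`Thm. 1.9 (core) ⇒ Thm. 1.8 (core)`** unconditionally in the comparison (`NSING ⊊ SING` for
`n, m ≥ 3` is the tree's theorem `makamWigderson2021_sec10_properSubset_holds`).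
[cite: MakamWigderson2021, Thm. 1.8 (proof, §10.2)] -/
theorem makamWigderson2021_thm_1_8_core_of_thm_1_9_core (h19 : makamWigderson2021_thm_1_9_core) :
    makamWigderson2021_thm_1_8_core :=
  makamWigderson2021_thm_1_8_core_of h19 makamWigderson2021_sec10_properSubset_holds

/-- **`Thm. 1.13 ⇒ Thm. 1.8 (core)`**: the whole null-cone chain of the source now hangs on the hard
inclusion of Thm. 1.13 alone. [cite: MakamWigderson2021, Thm. 1.8 (proof, §10.2)] -/
theorem makamWigderson2021_thm_1_8_core_of_thm_1_13 (h13 : makamWigderson2021_thm_1_13) :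
    makamWigderson2021_thm_1_8_core :=
  makamWigderson2021_thm_1_8_core_of_thm_1_9_core (makamWigderson2021_thm_1_9_core_of_thm_1_13 h13)

end Reductions

end Literature.Computability.AlgebraicComplexity

end
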